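import Summits.QuantumFields.YangMills.Theorems.FluctuationComparisonRegPrIntLS2BetaSourceCoeffClass
import HarnessLib

/-!
# S2β · (SCT″-c)₁ (SRC-E) ASSEMBLY — «THE LINEAR SOURCE ENERGY IS AN S′-SHARE — THE VOLUME ROAD» (px12 g27 RESHAPE (L2-VOL), desk RULING №128: (L2-TOWER) as displayed is refuted by the single-site gauge
# bump; the linear road needs NO gauge and NO ℓ²-decay letter): with the weights `w j := L^{K−J−1−j}`, the (BKG) class `θ_i := Cθ·L^{2i}∕L^{2(K−J)}` dominating M-1‴'s
# three class letters (`δ(i+1) ≤ θ_i`, `α(i+1) ≤ kα·θ_i`, `ᾱp(i+1) ≤ kp·θ_i`), and the tower input displayed per level by the VOLUME bound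
# `Σ_{b : PBond (F.P K) i} ‖X i b‖² ≤ L^{3(K−J−i)}·E i` ((L2-VOL): `E i := E′(K−J−1−i)`, every fine bond under a coarsest block read in the READ′ sup), the linear energy of
# ✓p839415 `Bsrc_split_le` (EM := the ℓ²-corner energy) is `E_lin ≤ 12·d²·Γ²·Cθ²·(Σ_{i<K−J} L^{K−J−1−i}·E i) ∕ L` — with (L2-VOL) an `S′`-SHARE `β_lin·S′`, `β_lin = 12d²Γ²C_B²α²∕L`
# (exponent ledger `1 + 2(K−J−1−i) + 4i + 3(K−J−i) = 4(K−J) + (K−J−1−i)`, K-uniform; px12's `t − 1`)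

Cell `ym3-torus` (YM ladder rung R3 = continuum `SU(2)` Yang–Mills on the three-torus at fixed lattice data — a RUNG: NOT d = 4, NOT infinite volume, NOT a mass gap,
NOT Clay).  Width seat «width 10» `ym3-torus-px10` (gen 26); crux `stmt-QuantumFields-20520`, LINE g18-1 S2β.  `--kind proof --supports stmt-QuantumFields-20520 --as helper`,
count-neutral, DEFINITION-FREE (0 `def`, 0 `instance`, 0 `notation`, 0 `sorry`, default heartbeats).

WHAT IS PROVED (sorry-free).  ★`geom_sum_le_pow` (kept: `Σ_{i<N} L^i ≤ L^N`, `2 ≤ L`); ★★`level_term_le` (per level: `L·L^{4(K−J)}·term_i ≤ 4d²Γ²Cθ²·(L^{4(K−J)}·(L^{K−J−1−i}·E i))`);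
★★★**`Elin_le_Sprime`**: `E_lin ≤ 12·d²·Γ²·Cθ²·(Σ_{i<K−J} L^{K−J−1−i}·E i) ∕ L` (`E_lin` = ✓`Bsrc_split_le`'s first summand at `w j := L^{K−J−1−j}`, `EM i := 4d²·Σ_b‖X i b‖²`, text as printed there).
WHAT IS LEFT by name for the c₁ column: (L2-VOL) (px12 g27 — unconditional lattice bookkeeping), the class ratios `kα, kp` and `Cθ = C_B·α` (w4 g29 (a) `…SourceClassesOfBkg`), `E_R` ((REG)),
`E_J` ((SUP-DECAY)₀), (T).

HONEST SCOPE.  Real exponent bookkeeping; (L2-VOL), the class relations, (BKG) are HYPOTHESES; nothing of Bałaban's renormalisation-group analysis is asserted or proved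
([Balaban1985Averaging] Prop. 4 (128)–(135) pp.37–38; [Balaban1987RG1] (0.11) p.253); GAP♯∘ (`stub_uniformFibreGapOrbit`, registry 3732b7df UNTOUCHED, 0∕5), S2β, the five
registered stubs, crux 20520, 19936, 19200 and `YM3TorusSU2` are NOT proved; no registered stub is closed; rung R3 — NOT d = 4, NOT infinite volume, NOT a mass gap, NOT Clay;
the Yang–Mills mass gap is NOT proved.
-/

set_option autoImplicit false

noncomputable section

open scoped Matrix.Norms.L2Operator
open Finset

namespace Summit.QuantumFields.YangMills.Theorems.FluctuationComparisonRegPrIntLS2BetaSourceEnergyLinearShare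

open Literature.MathematicalPhysics.QuantumFieldTheory.Balaban1983to89
open Literature.MathematicalPhysics.QuantumFieldTheory.Balaban1983to89.T4Continuum
open Literature.MathematicalPhysics.QuantumFieldTheory.Balaban1983to89.T3ContinuumYM3Torus
open Literature.MathematicalPhysics.QuantumFieldTheory.Balaban1983to89.T4HaarSU2ExpChart (expPoint)
open Literature.MathematicalPhysics.QuantumFieldTheory.Balaban1983to89.HaarExponentialChart
open Summit.QuantumFields.YangMills.Theorems.FluctuationComparisonRegPrIntLS2BetaSourceCoeffClass (srcCoeff_sq_le_class_sq)

/-- ★ `Σ_{i<N} L^i ≤ L^N` for `2 ≤ L`. [folklore] -/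
theorem geom_sum_le_pow {L : ℝ} (hL : 2 ≤ L) : ∀ N : ℕ, ∑ i ∈ Finset.range N, L ^ i ≤ L ^ N
  | 0 => by simp
  | N + 1 => by
      rw [Finset.sum_range_succ, pow_succ]
      have := geom_sum_le_pow hL N
      have h0 : 0 ≤ L ^ N := pow_nonneg (by linarith) _
      nlinarith

variable (F : T3Family)

/-- ★★ **PER LEVEL**: `L^{4(K−J)}·(L^{K−J−1−(i+1)})²·c̄(i+1)²·(4d²·S_i) ≤ 4d²·Γ²·Cθ²·T·L^{2(K−J)−2+i}` under the class relations at `θ_i` and scaled (L2-TOWER).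
[cite: Balaban1985Averaging, Prop. 4 (128)-(135) pp.37-38] -/
theorem level_term_le {J K : ℕ}
    (X : (i : ℕ) → PBond (F.P K) i → (specialUnitaryLogChart (Fin 2)).lie)
    (α δ αpb : ℕ → ℝ) (Cθ kα kp : ℝ)
    (i : ℕ) (hi : i < K - J)
    (hδ : δ (i + 1) ≤ (Cθ * (F.L : ℝ) ^ (2 * i) / (F.L : ℝ) ^ (2 * (K - J)))) (hα : α (i + 1) ≤ kα * (Cθ * (F.L : ℝ) ^ (2 * i) / (F.L : ℝ) ^ (2 * (K - J)))) (hαp : αpb (i + 1) ≤ kp * (Cθ * (F.L : ℝ) ^ (2 * i) / (F.L : ℝ) ^ (2 * (K - J))))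
    (hδ0 : 0 ≤ δ (i + 1)) (hα0 : 0 ≤ α (i + 1)) (hαp0 : 0 ≤ αpb (i + 1))
    (E : ℕ → ℝ) (hV : ∑ b : PBond (F.P K) i, ‖X i b‖ ^ 2 ≤ (F.L : ℝ) ^ (3 * (K - J - i)) * E i) :
    (F.L : ℝ) * (F.L : ℝ) ^ (4 * (K - J)) * ((F.L : ℝ) ^ (K - J - 1 - (i + 1)) * (F.L : ℝ) ^ (K - J - 1 - (i + 1)) *
          ((((F.P K).L : ℝ) * (((F.P K).L : ℝ) * (2 * δ (i + 1) * (((F.P K).L : ℝ) + 2 * (F.P K).L + 2))) + 48 * α (i + 1) * ((F.P K).L : ℝ) +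
            (2 * αpb (i + 1) * ((((F.P K).d + 2) * (F.P K).L : ℕ) : ℝ) + 24 * α (i + 1) * ((((F.P K).d + 2) * (F.P K).L : ℕ) : ℝ)) +
            4 * (404 * ((((F.P K).d + 2) * (F.P K).L : ℕ) : ℝ) * α (i + 1)) + 2 * δ (i + 1) * ((F.P K).L : ℝ) ^ 2) ^ 2 *
            (4 * ((F.P K).d : ℝ) ^ 2 * ∑ b : PBond (F.P K) i, ‖X i b‖ ^ 2))) ≤
      4 * ((F.P K).d : ℝ) ^ 2 * (2 * ((F.P K).L : ℝ) ^ 2 * (3 * (F.P K).L + 2) + 2 * ((F.P K).L : ℝ) ^ 2 + (48 * (F.P K).L + 24 * ((((F.P K).d + 2) * (F.P K).L : ℕ) : ℝ) + 1616 * ((((F.P K).d + 2) * (F.P K).L : ℕ) : ℝ)) * kα +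
        2 * ((((F.P K).d + 2) * (F.P K).L : ℕ) : ℝ) * kp) ^ 2 * Cθ ^ 2 *
        ((F.L : ℝ) ^ (4 * (K - J)) * ((F.L : ℝ) ^ (K - J - 1 - i) * E i)) := by
  have hL1 : (1 : ℝ) ≤ (F.L : ℝ) := by exact_mod_cast F.hL.2.le
  have hL0 : (0 : ℝ) < (F.L : ℝ) := lt_of_lt_of_le zero_lt_one hL1
  have hLK : ((F.P K).L : ℝ) = (F.L : ℝ) := by norm_cast
  -- the coefficient class
  have hc := srcCoeff_sq_le_class_sq (d := (F.P K).d) (Lnat := (F.P K).L) hδ hα hαp hδ0 hα0 hαp0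
  -- θ² · L^{4(K−J)} = Cθ² · L^{4i}
  have hθ : (Cθ * (F.L : ℝ) ^ (2 * i) / (F.L : ℝ) ^ (2 * (K - J))) ^ 2 * (F.L : ℝ) ^ (4 * (K - J)) = Cθ ^ 2 * (F.L : ℝ) ^ (4 * i) := by
    have hne : (F.L : ℝ) ^ (2 * (K - J)) ≠ 0 := pow_ne_zero _ hL0.ne'
    field_simp
    ring
  -- the weights: `(L^{K−J−1−(i+1)})² ≤ L^{2(K−J−1−i)}`
  have hw : (F.L : ℝ) ^ (K - J - 1 - (i + 1)) * (F.L : ℝ) ^ (K - J - 1 - (i + 1)) ≤ (F.L : ℝ) ^ (2 * (K - J - 1 - i)) := by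
    rw [← pow_add]
    exact pow_le_pow_right₀ hL1 (by omega)
  -- exponent identity (the volume road): `L · L^{2(K−J−1−i)} · L^{4i} · L^{3(K−J−i)} = L^{4(K−J)} · L^{K−J−1−i}`
  have hexp : (F.L : ℝ) * (F.L : ℝ) ^ (2 * (K - J - 1 - i)) * (F.L : ℝ) ^ (4 * i) * (F.L : ℝ) ^ (3 * (K - J - i)) =
      (F.L : ℝ) ^ (4 * (K - J)) * (F.L : ℝ) ^ (K - J - 1 - i) := by
    rw [← pow_succ', ← pow_add, ← pow_add, ← pow_add]
    congr 1
    omega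
  set S := ∑ b : PBond (F.P K) i, ‖X i b‖ ^ 2 with hS
  have hS0 : 0 ≤ S := Finset.sum_nonneg fun b _ => sq_nonneg _
  set cb := (((F.P K).L : ℝ) * (((F.P K).L : ℝ) * (2 * δ (i + 1) * (((F.P K).L : ℝ) + 2 * (F.P K).L + 2))) + 48 * α (i + 1) * ((F.P K).L : ℝ) +
            (2 * αpb (i + 1) * ((((F.P K).d + 2) * (F.P K).L : ℕ) : ℝ) + 24 * α (i + 1) * ((((F.P K).d + 2) * (F.P K).L : ℕ) : ℝ)) +
            4 * (404 * ((((F.P K).d + 2) * (F.P K).L : ℕ) : ℝ) * α (i + 1)) + 2 * δ (i + 1) * ((F.P K).L : ℝ) ^ 2) with hcb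
  set Γ := (2 * ((F.P K).L : ℝ) ^ 2 * (3 * (F.P K).L + 2) + 2 * ((F.P K).L : ℝ) ^ 2 + (48 * (F.P K).L + 24 * ((((F.P K).d + 2) * (F.P K).L : ℕ) : ℝ) + 1616 * ((((F.P K).d + 2) * (F.P K).L : ℕ) : ℝ)) * kα +
        2 * ((((F.P K).d + 2) * (F.P K).L : ℕ) : ℝ) * kp) with hΓ
  have hd0 : 0 ≤ 4 * ((F.P K).d : ℝ) ^ 2 := by positivity
  have hcw : cb ^ 2 * (F.L : ℝ) ^ (4 * (K - J)) ≤ Γ ^ 2 * (Cθ ^ 2 * (F.L : ℝ) ^ (4 * i)) := by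
    rw [← hθ, ← mul_assoc]
    exact mul_le_mul_of_nonneg_right (by rw [hcb, hΓ, hLK] at *; exact hLK ▸ hc) (pow_nonneg hL0.le _)
  -- step 1: weights and coefficient
  have h1 : (F.L : ℝ) * (F.L : ℝ) ^ (4 * (K - J)) * ((F.L : ℝ) ^ (K - J - 1 - (i + 1)) * (F.L : ℝ) ^ (K - J - 1 - (i + 1)) *
          (cb ^ 2 * (4 * ((F.P K).d : ℝ) ^ 2 * S))) ≤
      (F.L : ℝ) * ((F.L : ℝ) ^ (2 * (K - J - 1 - i)) * (Γ ^ 2 * (Cθ ^ 2 * (F.L : ℝ) ^ (4 * i)))) * (4 * ((F.P K).d : ℝ) ^ 2 * S) := by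
    calc (F.L : ℝ) * (F.L : ℝ) ^ (4 * (K - J)) * ((F.L : ℝ) ^ (K - J - 1 - (i + 1)) * (F.L : ℝ) ^ (K - J - 1 - (i + 1)) *
          (cb ^ 2 * (4 * ((F.P K).d : ℝ) ^ 2 * S)))
        = (F.L : ℝ) * (((F.L : ℝ) ^ (K - J - 1 - (i + 1)) * (F.L : ℝ) ^ (K - J - 1 - (i + 1))) *
            (cb ^ 2 * (F.L : ℝ) ^ (4 * (K - J)))) * (4 * ((F.P K).d : ℝ) ^ 2 * S) := by ring
      _ ≤ (F.L : ℝ) * ((F.L : ℝ) ^ (2 * (K - J - 1 - i)) * (Γ ^ 2 * (Cθ ^ 2 * (F.L : ℝ) ^ (4 * i)))) * (4 * ((F.P K).d : ℝ) ^ 2 * S) := by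
            have hB : 0 ≤ Γ ^ 2 * (Cθ ^ 2 * (F.L : ℝ) ^ (4 * i)) := by positivity
            exact mul_le_mul_of_nonneg_right (mul_le_mul_of_nonneg_left
              (mul_le_mul hw hcw (by positivity) (pow_nonneg hL0.le _)) hL0.le) (mul_nonneg hd0 hS0)
  -- step 2: the volume road `S ≤ L^{3(K−J−i)} · E i`
  have h2 : (F.L : ℝ) * ((F.L : ℝ) ^ (2 * (K - J - 1 - i)) * (Γ ^ 2 * (Cθ ^ 2 * (F.L : ℝ) ^ (4 * i)))) * (4 * ((F.P K).d : ℝ) ^ 2 * S) ≤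
      (F.L : ℝ) * ((F.L : ℝ) ^ (2 * (K - J - 1 - i)) * (Γ ^ 2 * (Cθ ^ 2 * (F.L : ℝ) ^ (4 * i)))) * (4 * ((F.P K).d : ℝ) ^ 2 * ((F.L : ℝ) ^ (3 * (K - J - i)) * E i)) :=
    mul_le_mul_of_nonneg_left (mul_le_mul_of_nonneg_left hV hd0) (by positivity)
  calc _ ≤ _ := h1
    _ ≤ _ := h2
    _ = 4 * ((F.P K).d : ℝ) ^ 2 * Γ ^ 2 * Cθ ^ 2 *
          (((F.L : ℝ) * (F.L : ℝ) ^ (2 * (K - J - 1 - i)) * (F.L : ℝ) ^ (4 * i) * (F.L : ℝ) ^ (3 * (K - J - i))) * E i) := by ring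
    _ = _ := by rw [hexp]; ring

/-- ★★★ **THE LINEAR SOURCE ENERGY IS AN `S′`-SHARE (VOLUME ROAD)**: `E_lin ≤ 12·d²·Γ²·Cθ²·(Σ_{i<K−J} L^{K−J−1−i}·E i) ∕ L` — sum of `level_term_le`, divide by
`L·L^{4(K−J)}`; with px12's (L2-VOL) `E i := E′(K−J−1−i)` the bracket is `Σ_t L^t·E′(t) = S′` after reflection, so `β_lin = 12d²Γ²Cθ²∕L`, `Cθ = C_B·α` (α²-small).
[cite: Balaban1985Averaging, Prop. 4 (128)-(135) pp.37-38; Balaban1987RG1, (0.11) p.253] -/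
theorem Elin_le_Sprime {J K : ℕ}
    (X : (i : ℕ) → PBond (F.P K) i → (specialUnitaryLogChart (Fin 2)).lie)
    (α δ αpb : ℕ → ℝ) (Cθ kα kp : ℝ)
    (hδ : ∀ i, i < K - J → δ (i + 1) ≤ (Cθ * (F.L : ℝ) ^ (2 * i) / (F.L : ℝ) ^ (2 * (K - J)))) (hα : ∀ i, i < K - J → α (i + 1) ≤ kα * (Cθ * (F.L : ℝ) ^ (2 * i) / (F.L : ℝ) ^ (2 * (K - J))))
    (hαp : ∀ i, i < K - J → αpb (i + 1) ≤ kp * (Cθ * (F.L : ℝ) ^ (2 * i) / (F.L : ℝ) ^ (2 * (K - J))))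
    (hδ0 : ∀ i, 0 ≤ δ i) (hα0 : ∀ i, 0 ≤ α i) (hαp0 : ∀ i, 0 ≤ αpb i)
    (E : ℕ → ℝ)
    (hV : ∀ i, i < K - J → ∑ b : PBond (F.P K) i, ‖X i b‖ ^ 2 ≤ (F.L : ℝ) ^ (3 * (K - J - i)) * E i) :
    3 * ∑ i ∈ Finset.range (K - J), (F.L : ℝ) ^ (K - J - 1 - (i + 1)) * (F.L : ℝ) ^ (K - J - 1 - (i + 1)) *
          ((((F.P K).L : ℝ) * (((F.P K).L : ℝ) * (2 * δ (i + 1) * (((F.P K).L : ℝ) + 2 * (F.P K).L + 2))) + 48 * α (i + 1) * ((F.P K).L : ℝ) +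
            (2 * αpb (i + 1) * ((((F.P K).d + 2) * (F.P K).L : ℕ) : ℝ) + 24 * α (i + 1) * ((((F.P K).d + 2) * (F.P K).L : ℕ) : ℝ)) +
            4 * (404 * ((((F.P K).d + 2) * (F.P K).L : ℕ) : ℝ) * α (i + 1)) + 2 * δ (i + 1) * ((F.P K).L : ℝ) ^ 2) ^ 2 *
            (4 * ((F.P K).d : ℝ) ^ 2 * ∑ b : PBond (F.P K) i, ‖X i b‖ ^ 2)) ≤
      12 * ((F.P K).d : ℝ) ^ 2 * (2 * ((F.P K).L : ℝ) ^ 2 * (3 * (F.P K).L + 2) + 2 * ((F.P K).L : ℝ) ^ 2 + (48 * (F.P K).L + 24 * ((((F.P K).d + 2) * (F.P K).L : ℕ) : ℝ) + 1616 * ((((F.P K).d + 2) * (F.P K).L : ℕ) : ℝ)) * kα +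
        2 * ((((F.P K).d + 2) * (F.P K).L : ℕ) : ℝ) * kp) ^ 2 * Cθ ^ 2 *
        (∑ i ∈ Finset.range (K - J), (F.L : ℝ) ^ (K - J - 1 - i) * E i) / (F.L : ℝ) := by
  have hL2' : (2 : ℝ) ≤ (F.L : ℝ) := by exact_mod_cast F.hL.2
  have hL0 : (0 : ℝ) < (F.L : ℝ) := by linarith
  set Γ := (2 * ((F.P K).L : ℝ) ^ 2 * (3 * (F.P K).L + 2) + 2 * ((F.P K).L : ℝ) ^ 2 + (48 * (F.P K).L + 24 * ((((F.P K).d + 2) * (F.P K).L : ℕ) : ℝ) + 1616 * ((((F.P K).d + 2) * (F.P K).L : ℕ) : ℝ)) * kα +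
        2 * ((((F.P K).d + 2) * (F.P K).L : ℕ) : ℝ) * kp) with hΓ
  have hpow : 0 < (F.L : ℝ) * (F.L : ℝ) ^ (4 * (K - J)) := mul_pos hL0 (pow_pos hL0 _)
  rw [le_div_iff₀ hL0]
  set s := ∑ i ∈ Finset.range (K - J), (F.L : ℝ) ^ (K - J - 1 - (i + 1)) * (F.L : ℝ) ^ (K - J - 1 - (i + 1)) *
          ((((F.P K).L : ℝ) * (((F.P K).L : ℝ) * (2 * δ (i + 1) * (((F.P K).L : ℝ) + 2 * (F.P K).L + 2))) + 48 * α (i + 1) * ((F.P K).L : ℝ) +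
            (2 * αpb (i + 1) * ((((F.P K).d + 2) * (F.P K).L : ℕ) : ℝ) + 24 * α (i + 1) * ((((F.P K).d + 2) * (F.P K).L : ℕ) : ℝ)) +
            4 * (404 * ((((F.P K).d + 2) * (F.P K).L : ℕ) : ℝ) * α (i + 1)) + 2 * δ (i + 1) * ((F.P K).L : ℝ) ^ 2) ^ 2 *
            (4 * ((F.P K).d : ℝ) ^ 2 * ∑ b : PBond (F.P K) i, ‖X i b‖ ^ 2)) with hs
  -- the sum of the per-level bounds
  have hsum : (F.L : ℝ) * (F.L : ℝ) ^ (4 * (K - J)) * s ≤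
      4 * ((F.P K).d : ℝ) ^ 2 * Γ ^ 2 * Cθ ^ 2 * ((F.L : ℝ) ^ (4 * (K - J)) * ∑ i ∈ Finset.range (K - J), (F.L : ℝ) ^ (K - J - 1 - i) * E i) := by
    rw [hs, Finset.mul_sum, Finset.mul_sum, Finset.mul_sum]
    refine Finset.sum_le_sum fun i hi => ?_
    have hi' := Finset.mem_range.1 hi
    have h := level_term_le F X α δ αpb Cθ kα kp i hi' (hδ i hi') (hα i hi') (hαp i hi') (hδ0 _) (hα0 _) (hαp0 _) E (hV i hi')
    rw [← hΓ] at h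
    exact h
  have h1 : ((F.L : ℝ) * (F.L : ℝ) ^ (4 * (K - J))) * (3 * s * (F.L : ℝ)) ≤
      ((F.L : ℝ) * (F.L : ℝ) ^ (4 * (K - J))) * (12 * ((F.P K).d : ℝ) ^ 2 * Γ ^ 2 * Cθ ^ 2 *
        ∑ i ∈ Finset.range (K - J), (F.L : ℝ) ^ (K - J - 1 - i) * E i) := by
    have h3 := mul_le_mul_of_nonneg_left hsum (show (0:ℝ) ≤ 3 * (F.L : ℝ) by positivity)
    calc ((F.L : ℝ) * (F.L : ℝ) ^ (4 * (K - J))) * (3 * s * (F.L : ℝ))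
        = 3 * (F.L : ℝ) * ((F.L : ℝ) * (F.L : ℝ) ^ (4 * (K - J)) * s) := by ring
      _ ≤ 3 * (F.L : ℝ) * (4 * ((F.P K).d : ℝ) ^ 2 * Γ ^ 2 * Cθ ^ 2 * ((F.L : ℝ) ^ (4 * (K - J)) * ∑ i ∈ Finset.range (K - J), (F.L : ℝ) ^ (K - J - 1 - i) * E i)) := h3
      _ = _ := by ring
  exact le_of_mul_le_mul_left h1 hpow

end Summit.QuantumFields.YangMills.Theorems.FluctuationComparisonRegPrIntLS2BetaSourceEnergyLinearShare

end
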